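import Summits.SmoothPoincare4.SmoothPoincare4.Theorems.ConvexBisectionAcyclicBisectionExistsBeltReturnReflect
import HarnessLib

/-!
# N1 ▸ `node_N1_move` ▸ (d) N1-mono ▸ piece (d9), brick J2-2: THE INTEGER OF THE LINEAR BELT MODEL
(wave 8, crux stmt-SmoothPoincare4-10508, line `modp-braid-orbits`, registered stub `stub_M2geo` (N1) ▸
`node_N1_move` ▸ sub-node (d) `helper_N1_beltMonodromy` ▸ piece (d9); registered sub-goal
`helper_linearBeltReturn_integer`)

Piece (d9) of H4-REPORT §4 is the Picard–Lefschetz integer `n₀ = ±1` of the return map `G` of the (d) statement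
(`G = id` below, `G (u, r) = (u + n₀, r)` above).  Route A computes it on the LINEAR MODEL (the blow-up
`Q (u, λ m)/λ → Q₀` at `λ = 0`) and carries it to `λ = 1` by continuity.  This file is the linear model:

* belt coordinates `(u, m) ∈ ℝ × ℝ²`, page function `Q₀ (u, m) = ⟪M û, m⟫` (`û = e^{2πiu}`, `M` = the belt matrix of
  `helper_beltSlope_hasFDerivAt`, injective); Kosinski gluing `(û, r • v) ↔ (v, r • û)`: the belt point `(u, m)`,
  `m ≠ 0`, is the base tube point of core angle `v = m/‖m‖` and fibre vector `m' = ‖m‖ • û`, and there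
  `Q₀ = ⟪M m', v⟫` (`linearBelt_base_reading`);
* §1 the belt TRANSPORT from the page `Q₀ = -η` to the page `Q₀ = +η` along the fibrewise gradient line
  `s ↦ m + (s/‖Mû‖²) • M û` (`dQ₀ = 1`, `linearBelt_level_along_line`) is `m ↦ m - (2⟪Mû, m⟫/‖Mû‖²) • Mû`, THE
  REFLECTION of `m` in the line `(M û)^⊥` (`linearBelt_transport_eq_reflect`): it preserves `‖m‖`, so in base
  coordinates it is `(v, m') ↦ (refl_{M m'} v, m')` (`linearBelt_return_base`) — THE EXPLICIT RETURN MAP OF THE LINEAR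
  MODEL (a chord of a round fibre disc parallel to `M û` is symmetric in `(M û)^⊥`);
* §2 THE INTEGER (registered `helper_linearBeltReturn_integer`): along an affine chart line `m' (r') = r' • A - η • C`
  of the base page `-η` at the core angle `v` (`⟪v, M A⟫ = 0`, `⟪v, M C⟫ = 1`; the blow-up of any fibred chart family
  of the (d) statement is of this form) the directions of `m' (r')`, `r'` from `-∞` to `+∞`, are those of
  `cos (πs) • A + sin (πs) • C`, `s` from `0` to `1` (`chartLine_eq_smul_halfTurn` of `…BeltReturnLift.lean`), and
  `wind (s ↦ refl_{M (cos (πs) • A + sin (πs) • C)} v) = σ κ`, `σ = sign det M`, `κ = sign det (A, C)`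
  (`helper_wind_reflect_halfTurn` of brick J2-1 for the matrix `M ∘ [A | C]`) — the displacement integer
  `n₀ = d₊ - d₋` of the return map in the chart coordinates `(t, r')`; the loop closes at `v` itself
  (`linearBeltReturn_endpoints`), the sign of `det M` may be supplied as a winding number
  (`linearBeltReturn_integer_of_wind`), and the half-turn form (`linearBeltReturn_integer_halfTurn`);
* §3 the bookkeeping (`linearBeltReturn_sign`, `linearBeltReturn_integer_eq_ite`): with `σ = -ε · tw` (G2's count,
  H4-REPORT §2; as plane algebra: `helper_signDet_of_frameRows` of `…BeltReturnSignDet.lean`) and `κ = ε` (the chart is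
  positively oriented; as plane algebra: `chartSign_eq_frameSign`), `σ κ = if s then 1 else -1` — right-handed iff the
  letter is positive.
Everything is proved; no named facts, no `sorry`.  References: A. A. Kosinski, *Differential Manifolds* (1993),
VI §6 [Kosinski1993]; R. E. Gompf, A. I. Stipsicz, *4-Manifolds and Kirby Calculus* (1999), §8.2
[GompfStipsicz1999]; W. Fulton, *Algebraic Topology: A First Course* (1995), §3 [Fulton1995].
-/

noncomputable section

set_option linter.dupNamespace false

open scoped Manifold ContDiff Topology ComplexConjugate
open Set Function Complex Filter
open Literature.Topology.FourManifolds Literature.Topology.PlaneTopology Literature.Geometry.Symplectic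

namespace Summit.SmoothPoincare4.SmoothPoincare4.Theorems.AcyclicBisectionExists.ModpBraidOrbits

/-! ## §1 The linear belt model: transport = reflection, and its reading in base coordinates -/

/-- **`dQ₀ = 1` along the fibrewise gradient line**: `⟪w, m + (s/‖w‖²) w⟫ = ⟪w, m⟫ + s` (`w = M û ≠ 0`).
[cite: Kosinski1993, VI §6] -/
theorem linearBelt_level_along_line {w : EuclideanSpace ℝ (Fin 2)} (hw : w ≠ 0)
    (m : EuclideanSpace ℝ (Fin 2)) (s : ℝ) :
    inner ℝ w (m + (s / ‖w‖ ^ 2) • w) = inner ℝ w m + s := by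
  have hn : ‖w‖ ^ 2 ≠ 0 := pow_ne_zero _ (norm_ne_zero_iff.2 hw)
  rw [inner_add_right, real_inner_smul_right, real_inner_self_eq_norm_sq, div_mul_cancel₀ _ hn]

/-- The fibrewise gradient line has unit `Q₀`-speed: `d/ds ⟪w, m + (s/‖w‖²) w⟫ = 1`. [cite: Kosinski1993, VI §6] -/
theorem hasDerivAt_linearBelt_level {w : EuclideanSpace ℝ (Fin 2)} (hw : w ≠ 0)
    (m : EuclideanSpace ℝ (Fin 2)) (s : ℝ) :
    HasDerivAt (fun s' : ℝ => inner ℝ w (m + (s' / ‖w‖ ^ 2) • w)) 1 s := by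
  simp_rw [linearBelt_level_along_line hw]
  simpa using (hasDerivAt_id s).const_add (inner ℝ w m)

/-- **The belt transport of the linear model is the reflection**: from the page `⟪w, m⟫ = -η` the time-`2η` map of
the gradient line, `m ↦ m + (2η/‖w‖²) w`, is `refl_w m = m - (2⟪w, m⟫/‖w‖²) w`; it lands on the page `+η` with
the same norm. [cite: GompfStipsicz1999, §8.2] -/
theorem linearBelt_transport_eq_reflect {w m : EuclideanSpace ℝ (Fin 2)} (hw : w ≠ 0) {η : ℝ}
    (hm : inner ℝ w m = -η) :
    m + (2 * η / ‖w‖ ^ 2) • w = m - (2 * inner ℝ w m / ‖w‖ ^ 2) • w ∧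
      inner ℝ w (m + (2 * η / ‖w‖ ^ 2) • w) = η ∧ ‖m + (2 * η / ‖w‖ ^ 2) • w‖ = ‖m‖ := by
  have he : m + (2 * η / ‖w‖ ^ 2) • w = m - (2 * inner ℝ w m / ‖w‖ ^ 2) • w := by
    rw [hm, sub_eq_add_neg, ← neg_smul]
    congr 2
    ring
  refine ⟨he, ?_, ?_⟩
  · rw [he, inner_reflectLine hw, hm, neg_neg]
  · rw [he, norm_reflectLine hw]

/-- **Kosinski reading**: under the gluing `(û, r • v) ↔ (v, r • û)` the belt page function `⟪M û, r • v⟫` is the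
base page function `⟪M m', v⟫`, `m' = r • û`. [cite: Kosinski1993, VI §6] -/
theorem linearBelt_base_reading (M : EuclideanSpace ℝ (Fin 2) →L[ℝ] EuclideanSpace ℝ (Fin 2))
    (u v : EuclideanSpace ℝ (Fin 2)) (r : ℝ) :
    inner ℝ (M u) (r • v) = inner ℝ (M (r • u)) v := by
  rw [real_inner_smul_right, map_smul, real_inner_smul_left]

/-- **The return map of the linear model in base coordinates**: the transported belt point
`(û, refl_{Mû} (r • v))` is glued to the base point of core angle `refl_{M m'} v` and the SAME fibre vector
`m' = r • û` (`refl` is linear and only depends on the line `ℝ · M m' = ℝ · M û`). [cite: GompfStipsicz1999, §8.2] -/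
theorem linearBelt_return_base (M : EuclideanSpace ℝ (Fin 2) →L[ℝ] EuclideanSpace ℝ (Fin 2))
    (u v : EuclideanSpace ℝ (Fin 2)) {r : ℝ} (hr : r ≠ 0) :
    r • v - (2 * inner ℝ (M u) (r • v) / ‖M u‖ ^ 2) • M u =
      r • (v - (2 * inner ℝ (M (r • u)) v / ‖M (r • u)‖ ^ 2) • M (r • u)) := by
  rw [reflectLine_smul, map_smul, reflectLine_line hr]

/-! ## §2 The integer of the linear model -/

/-- **The lines of the half-turn are non-degenerate**: `M (cos (πs) • A + sin (πs) • C) ≠ 0` when `det M ≠ 0` and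
`det (A, C) ≠ 0` (sign form). [folklore] -/
theorem linearBelt_halfTurn_ne_zero (M : EuclideanSpace ℝ (Fin 2) →L[ℝ] EuclideanSpace ℝ (Fin 2)) {σ κ : ℤ}
    (hdet : 0 < (σ : ℝ) * (M (EuclideanSpace.single 0 1) 0 * M (EuclideanSpace.single 1 1) 1 -
      M (EuclideanSpace.single 1 1) 0 * M (EuclideanSpace.single 0 1) 1))
    {A C : EuclideanSpace ℝ (Fin 2)} (hAC : 0 < (κ : ℝ) * (A 0 * C 1 - A 1 * C 0)) (s : ℝ) :
    M (Real.cos (Real.pi * s) • A + Real.sin (Real.pi * s) • C) ≠ 0 := by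
  intro h0
  have hMA : M A = A 0 • M (EuclideanSpace.single 0 1) + A 1 • M (EuclideanSpace.single 1 1) := by
    conv_lhs => rw [eq_smul_single_add A]
    rw [map_add, map_smul, map_smul]
  have hMC : M C = C 0 • M (EuclideanSpace.single 0 1) + C 1 • M (EuclideanSpace.single 1 1) := by
    conv_lhs => rw [eq_smul_single_add C]
    rw [map_add, map_smul, map_smul]
  have hD : M (EuclideanSpace.single 0 1) 0 * M (EuclideanSpace.single 1 1) 1 -
      M (EuclideanSpace.single 1 1) 0 * M (EuclideanSpace.single 0 1) 1 ≠ 0 := by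
    intro h; rw [h, mul_zero] at hdet; exact lt_irrefl _ hdet
  have hE : A 0 * C 1 - A 1 * C 0 ≠ 0 := by
    intro h; rw [h, mul_zero] at hAC; exact lt_irrefl _ hAC
  have h1 := congrArg (fun x : EuclideanSpace ℝ (Fin 2) => x 0) h0
  have h2 := congrArg (fun x : EuclideanSpace ℝ (Fin 2) => x 1) h0
  simp only [map_add, map_smul, hMA, hMC, PiLp.add_apply, PiLp.smul_apply, smul_eq_mul, PiLp.zero_apply] at h1 h2
  -- the composite matrix `M ∘ [A | C]` applied to `(cos, sin) ≠ 0` vanishes: its determinant is `det M · det (A, C)`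
  have key := linearLoop_ne_zero (a := M A 0) (b := M C 0) (c := M A 1) (d := M C 1) (t := s / 2) (by
    simp only [hMA, hMC, PiLp.add_apply, PiLp.smul_apply, smul_eq_mul]
    have : (A 0 * M (EuclideanSpace.single 0 1) 0 + A 1 * M (EuclideanSpace.single 1 1) 0) *
        (C 0 * M (EuclideanSpace.single 0 1) 1 + C 1 * M (EuclideanSpace.single 1 1) 1) -
        (C 0 * M (EuclideanSpace.single 0 1) 0 + C 1 * M (EuclideanSpace.single 1 1) 0) *
        (A 0 * M (EuclideanSpace.single 0 1) 1 + A 1 * M (EuclideanSpace.single 1 1) 1) =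
        (M (EuclideanSpace.single 0 1) 0 * M (EuclideanSpace.single 1 1) 1 -
          M (EuclideanSpace.single 1 1) 0 * M (EuclideanSpace.single 0 1) 1) * (A 0 * C 1 - A 1 * C 0) := by ring
    rw [this]; exact mul_ne_zero hD hE)
  apply key
  have e : 2 * Real.pi * (s / 2) = Real.pi * s := by ring
  rw [e]
  apply Complex.ext
  · simp only [hMA, hMC, PiLp.add_apply, PiLp.smul_apply, smul_eq_mul, Complex.zero_re]
    linear_combination h1
  · simp only [hMA, hMC, PiLp.add_apply, PiLp.smul_apply, smul_eq_mul, Complex.zero_im]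
    linear_combination h2

/-- **THE INTEGER OF THE LINEAR BELT MODEL** (piece (d9) of N1-mono on the linear model `Q₀ (u, m) = ⟪M û, m⟫` with
the scale-invariant gluing `(û, r • v) ↔ (v, r • û)`).  Along the affine chart line of directions
`cos (πs) • A + sin (πs) • C`, `s ∈ [0, 1]` (`= r' • A - η • C`, `r'` from `-∞` to `+∞`, up to scalars), the core
angle `v` reflected in the lines `(M (cos (πs) • A + sin (πs) • C))^⊥` — the return map of the linear model read in
the chart — is a closed loop of winding number `σ κ`, `σ = sign det M`, `κ = sign det (A, C)`: the displacement
integer `n₀ = d₊ - d₋` of the return map between the two sides of the chart. [cite: GompfStipsicz1999, §8.2] -/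
theorem helper_linearBeltReturn_integer : ∀ (M : EuclideanSpace ℝ (Fin 2) →L[ℝ] EuclideanSpace ℝ (Fin 2)) (σ κ : ℤ), (σ = 1 ∨ σ = -1) → (κ = 1 ∨ κ = -1) → 0 < (σ : ℝ) * (M (EuclideanSpace.single 0 1) 0 * M (EuclideanSpace.single 1 1) 1 - M (EuclideanSpace.single 1 1) 0 * M (EuclideanSpace.single 0 1) 1) → ∀ (A C : EuclideanSpace ℝ (Fin 2)), 0 < (κ : ℝ) * (A 0 * C 1 - A 1 * C 0) → ∀ (v : EuclideanSpace ℝ (Fin 2)), v ≠ 0 → Literature.Topology.PlaneTopology.wind (fun s : ℝ => Literature.Topology.FourManifolds.toC (v - (2 * inner ℝ (M (Real.cos (Real.pi * s) • A + Real.sin (Real.pi * s) • C)) v / ‖M (Real.cos (Real.pi * s) • A + Real.sin (Real.pi * s) • C)‖ ^ 2) • M (Real.cos (Real.pi * s) • A + Real.sin (Real.pi * s) • C))) = σ * κ := by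
  intro M σ κ hσ hκ hdet A C hAC v hv
  -- the entries of the composite matrix `M ∘ [A | C]`
  set a := M A 0 with ha
  set b := M C 0 with hb
  set c := M A 1 with hc
  set d := M C 1 with hd
  have hMA : M A = A 0 • M (EuclideanSpace.single 0 1) + A 1 • M (EuclideanSpace.single 1 1) := by
    conv_lhs => rw [eq_smul_single_add A]
    rw [map_add, map_smul, map_smul]
  have hMC : M C = C 0 • M (EuclideanSpace.single 0 1) + C 1 • M (EuclideanSpace.single 1 1) := by
    conv_lhs => rw [eq_smul_single_add C]
    rw [map_add, map_smul, map_smul]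
  have hdet' : a * d - b * c =
      (M (EuclideanSpace.single 0 1) 0 * M (EuclideanSpace.single 1 1) 1 -
        M (EuclideanSpace.single 1 1) 0 * M (EuclideanSpace.single 0 1) 1) * (A 0 * C 1 - A 1 * C 0) := by
    simp only [ha, hb, hc, hd, hMA, hMC, PiLp.add_apply, PiLp.smul_apply, smul_eq_mul]
    ring
  have hστ : σ * κ = 1 ∨ σ * κ = -1 := by
    rcases hσ with rfl | rfl <;> rcases hκ with rfl | rfl <;> norm_num
  have hpos : 0 < ((σ * κ : ℤ) : ℝ) * (a * d - b * c) := by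
    rw [hdet', Int.cast_mul]
    have := mul_pos hdet hAC
    linarith [this]
  -- the loop of normals is the half-turn of the linear loop of `M ∘ [A | C]`
  have hw : ∀ s : ℝ, toC (M (Real.cos (Real.pi * s) • A + Real.sin (Real.pi * s) • C)) =
      (⟨a * Real.cos (2 * Real.pi * (s / 2)) + b * Real.sin (2 * Real.pi * (s / 2)),
        c * Real.cos (2 * Real.pi * (s / 2)) + d * Real.sin (2 * Real.pi * (s / 2))⟩ : ℂ) := by
    intro s
    have e : 2 * Real.pi * (s / 2) = Real.pi * s := by ring
    rw [e, map_add, map_smul, map_smul]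
    apply Complex.ext <;> simp [toC, ha, hb, hc, hd] <;> ring
  have hdet0 : a * d - b * c ≠ 0 := by
    intro h0; rw [h0, mul_zero] at hpos; exact lt_irrefl _ hpos
  have hne : ∀ s : ℝ, M (Real.cos (Real.pi * s) • A + Real.sin (Real.pi * s) • C) ≠ 0 := by
    intro s h0
    have := linearLoop_ne_zero hdet0 (s / 2)
    rw [← hw s, h0] at this
    exact this (by apply Complex.ext <;> simp [toC])
  have hfun : (fun s : ℝ => toC (v - (2 * inner ℝ (M (Real.cos (Real.pi * s) • A + Real.sin (Real.pi * s) • C)) v /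
      ‖M (Real.cos (Real.pi * s) • A + Real.sin (Real.pi * s) • C)‖ ^ 2) •
        M (Real.cos (Real.pi * s) • A + Real.sin (Real.pi * s) • C))) =
      fun s : ℝ => -conj (toC v) *
        (⟨a * Real.cos (2 * Real.pi * (s / 2)) + b * Real.sin (2 * Real.pi * (s / 2)),
          c * Real.cos (2 * Real.pi * (s / 2)) + d * Real.sin (2 * Real.pi * (s / 2))⟩ : ℂ) /
        conj (⟨a * Real.cos (2 * Real.pi * (s / 2)) + b * Real.sin (2 * Real.pi * (s / 2)),
          c * Real.cos (2 * Real.pi * (s / 2)) + d * Real.sin (2 * Real.pi * (s / 2))⟩ : ℂ) := by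
    funext s
    rw [toC_reflectLine (hne s), hw s]
  rw [hfun, helper_wind_reflect_halfTurn a b c d (σ * κ) hστ hpos (toC v) (PlaneComplex.toC_ne_zero hv)]

/-- **The loop closes at the core angle itself**: at `s = 0` and `s = 1` the line is `(M A)^⊥ ∋ v`
(`⟪M A, v⟫ = 0`: `A` is tangent to the base page through `v`), so the reflected vector is `v` — the displacements
`d₋`, `d₊` of the return map at `r' = ∓∞` are integers. [cite: GompfStipsicz1999, §8.2] -/
theorem linearBeltReturn_endpoints (M : EuclideanSpace ℝ (Fin 2) →L[ℝ] EuclideanSpace ℝ (Fin 2))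
    (A C v : EuclideanSpace ℝ (Fin 2)) (hA : inner ℝ (M A) v = 0) (s : ℝ) (hs : s = 0 ∨ s = 1) :
    v - (2 * inner ℝ (M (Real.cos (Real.pi * s) • A + Real.sin (Real.pi * s) • C)) v /
        ‖M (Real.cos (Real.pi * s) • A + Real.sin (Real.pi * s) • C)‖ ^ 2) •
      M (Real.cos (Real.pi * s) • A + Real.sin (Real.pi * s) • C) = v := by
  rcases hs with rfl | rfl
  · rw [mul_zero, Real.cos_zero, Real.sin_zero, one_smul, zero_smul, add_zero]
    exact reflectLine_of_inner_eq_zero hA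
  · rw [mul_one, Real.cos_pi, Real.sin_pi, zero_smul, add_zero, map_smul, reflectLine_line (by norm_num)]
    exact reflectLine_of_inner_eq_zero hA

/-- **The integer with the sign of `det M` supplied as a WINDING NUMBER** (the currency of G2's count
`wind (t ↦ M e^{2πit}) = -ε · tw`): same conclusion as `helper_linearBeltReturn_integer`.
[cite: GompfStipsicz1999, §8.2] -/
theorem linearBeltReturn_integer_of_wind (M : EuclideanSpace ℝ (Fin 2) →L[ℝ] EuclideanSpace ℝ (Fin 2))
    (hM : Injective M) {σ κ : ℤ} (hσ : wind (fun t => toC (M (circlePt t : EuclideanSpace ℝ (Fin 2)))) = σ)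
    (hκ : κ = 1 ∨ κ = -1) (A C : EuclideanSpace ℝ (Fin 2)) (hAC : 0 < (κ : ℝ) * (A 0 * C 1 - A 1 * C 0))
    (v : EuclideanSpace ℝ (Fin 2)) (hv : v ≠ 0) :
    wind (fun s : ℝ => toC (v - (2 * inner ℝ (M (Real.cos (Real.pi * s) • A + Real.sin (Real.pi * s) • C)) v /
      ‖M (Real.cos (Real.pi * s) • A + Real.sin (Real.pi * s) • C)‖ ^ 2) •
        M (Real.cos (Real.pi * s) • A + Real.sin (Real.pi * s) • C))) = σ * κ := by
  have hD := det_entries_ne_zero_of_injective hM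
  rcases lt_or_gt_of_ne hD with hneg | hpos
  · have h1 : 0 < ((-1 : ℤ) : ℝ) * (M (EuclideanSpace.single 0 1) 0 * M (EuclideanSpace.single 1 1) 1 -
        M (EuclideanSpace.single 1 1) 0 * M (EuclideanSpace.single 0 1) 1) := by push_cast; linarith
    have hw := wind_clm_circlePt M (Or.inr rfl) h1
    rw [hσ] at hw
    subst hw
    exact helper_linearBeltReturn_integer M (-1) κ (Or.inr rfl) hκ h1 A C hAC v hv
  · have h1 : 0 < ((1 : ℤ) : ℝ) * (M (EuclideanSpace.single 0 1) 0 * M (EuclideanSpace.single 1 1) 1 -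
        M (EuclideanSpace.single 1 1) 0 * M (EuclideanSpace.single 0 1) 1) := by push_cast; linarith
    have hw := wind_clm_circlePt M (Or.inl rfl) h1
    rw [hσ] at hw
    subst hw
    exact helper_linearBeltReturn_integer M 1 κ (Or.inl rfl) hκ h1 A C hAC v hv

/-- **The half-turn form** (chart frame `A = e₀`, `C = e₁`, `κ = 1`): reflecting `v ≠ 0` in the lines
`(M e^{iπs})^⊥`, `s ∈ [0, 1]`, winds `sign det M` times. [cite: Fulton1995, §3] -/
theorem linearBeltReturn_integer_halfTurn (M : EuclideanSpace ℝ (Fin 2) →L[ℝ] EuclideanSpace ℝ (Fin 2))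
    {σ : ℤ} (hσ : σ = 1 ∨ σ = -1)
    (hdet : 0 < (σ : ℝ) * (M (EuclideanSpace.single 0 1) 0 * M (EuclideanSpace.single 1 1) 1 -
      M (EuclideanSpace.single 1 1) 0 * M (EuclideanSpace.single 0 1) 1))
    (v : EuclideanSpace ℝ (Fin 2)) (hv : v ≠ 0) :
    wind (fun s : ℝ => toC (v - (2 * inner ℝ (M (circlePt (s / 2) : EuclideanSpace ℝ (Fin 2))) v /
      ‖M (circlePt (s / 2) : EuclideanSpace ℝ (Fin 2))‖ ^ 2) • M (circlePt (s / 2) : EuclideanSpace ℝ (Fin 2)))) =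
      σ := by
  have e : ∀ s : ℝ, (circlePt (s / 2) : EuclideanSpace ℝ (Fin 2)) =
      Real.cos (Real.pi * s) • EuclideanSpace.single 0 1 + Real.sin (Real.pi * s) • EuclideanSpace.single 1 1 := by
    intro s
    conv_lhs => rw [eq_smul_single_add (circlePt (s / 2) : EuclideanSpace ℝ (Fin 2))]
    rw [circlePt_apply_zero, circlePt_apply_one, show 2 * Real.pi * (s / 2) = Real.pi * s by ring]
  simp_rw [e]
  have h := helper_linearBeltReturn_integer M σ 1 hσ (Or.inl rfl) hdet (EuclideanSpace.single 0 1)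
    (EuclideanSpace.single 1 1) (by simp) v hv
  rw [h, mul_one]

/-! ## §3 The sign bookkeeping: right-handed iff the letter is positive -/

/-- **`n₀ = if s then 1 else -1`**: with `σ = sign det M = -ε · tw` (G2's count through `wind_frameRow`: rows wind
opposite to columns; `tw = pageTwisting = if s then -1 else 1`) and `κ = sign det (A, C) = ε` (the chart `(t, r')` of
the page is POSITIVELY oriented iff its transverse direction `A` has the character `ε` = frameSign of the Kosinski tube
against the page frame `(iK', rot)`), the displacement integer `σ κ` of the linear model is `+1` (right-handed Dehn
twist) iff `s = true` — all four cases `(ε, tw)` of H4-REPORT §2. [cite: GompfStipsicz1999, §8.2] -/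
theorem linearBeltReturn_sign {σ κ ε tw : ℤ} {s : Bool} (hε : ε = 1 ∨ ε = -1)
    (htw : tw = if s then -1 else 1) (hσ : σ = -ε * tw) (hκ : κ = ε) :
    σ * κ = if s then 1 else -1 := by
  subst hκ hσ htw
  rcases hε with rfl | rfl <;> cases s <;> norm_num

/-- **The chart is positively oriented iff `κ = ε`** (the sign input `hκ` of `linearBeltReturn_sign` as plane algebra).
Read the input chart of (d) at a core point through the Kosinski tube and Z4's page tube (transition matrix
`A (v) = [[f₁, g₁], [f₂, g₂]]`, `0 < ε det A (v)`): its transverse direction `A = (A₀, A₁)` is tangent to the belt page,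
i.e. killed by the second row (`f₂ A₀ + g₂ A₁ = 0`, the `rot`-component vanishes), the chart is POSITIVELY oriented iff the
`iK'`-component `f₁ A₀ + g₁ A₁` of `D_v A` is positive, and the level direction `C` has `⟪Mᵀ v, C⟫ ∝ f₂ C₀ + g₂ C₁ > 0`;
then `sign det (A, C) = ε`:  `(A₀ C₁ - A₁ C₀) · det A (v) = (f₁ A₀ + g₁ A₁) (f₂ C₀ + g₂ C₁)`. [cite: GompfStipsicz1999, §8.2] -/
theorem chartSign_eq_frameSign {f₁ g₁ f₂ g₂ A₀ A₁ C₀ C₁ : ℝ} {ε : ℤ} (hε : ε = 1 ∨ ε = -1)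
    (hdet : 0 < (ε : ℝ) * (f₁ * g₂ - g₁ * f₂)) (hA : f₂ * A₀ + g₂ * A₁ = 0) (hpos : 0 < f₁ * A₀ + g₁ * A₁)
    (hC : 0 < f₂ * C₀ + g₂ * C₁) : 0 < (ε : ℝ) * (A₀ * C₁ - A₁ * C₀) := by
  have key : (A₀ * C₁ - A₁ * C₀) * (f₁ * g₂ - g₁ * f₂) = (f₁ * A₀ + g₁ * A₁) * (f₂ * C₀ + g₂ * C₁) := by
    linear_combination (-(g₁ * C₁ + f₁ * C₀)) * hA
  have hε2 : (ε : ℝ) * ε = 1 := by rcases hε with rfl | rfl <;> norm_num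
  have hprod : 0 < (A₀ * C₁ - A₁ * C₀) * (f₁ * g₂ - g₁ * f₂) := by rw [key]; exact mul_pos hpos hC
  -- `ε (A₀C₁ - A₁C₀) = [(A₀C₁ - A₁C₀) det] · ε / (ε · ε det)`-type sign chase
  have h1 : 0 < (ε : ℝ) * (A₀ * C₁ - A₁ * C₀) * ((ε : ℝ) * (f₁ * g₂ - g₁ * f₂)) := by
    have : (ε : ℝ) * (A₀ * C₁ - A₁ * C₀) * ((ε : ℝ) * (f₁ * g₂ - g₁ * f₂)) =
        (ε : ℝ) * ε * ((A₀ * C₁ - A₁ * C₀) * (f₁ * g₂ - g₁ * f₂)) := by ring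
    rw [this, hε2, one_mul]; exact hprod
  exact pos_of_mul_pos_left h1 hdet.le

/-- **THE INTEGER OF THE LINEAR MODEL IS `if s then 1 else -1`** (the registered integer combined with the
bookkeeping): under the sign inputs of H4-REPORT §2 the reflected core angle along a positively oriented chart line
winds `+1` times iff the letter is positive. [cite: GompfStipsicz1999, §8.2] -/
theorem linearBeltReturn_integer_eq_ite (M : EuclideanSpace ℝ (Fin 2) →L[ℝ] EuclideanSpace ℝ (Fin 2))
    {ε tw : ℤ} {s : Bool} (hε : ε = 1 ∨ ε = -1) (htw : tw = if s then -1 else 1)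
    (hdet : 0 < ((-ε * tw : ℤ) : ℝ) * (M (EuclideanSpace.single 0 1) 0 * M (EuclideanSpace.single 1 1) 1 -
      M (EuclideanSpace.single 1 1) 0 * M (EuclideanSpace.single 0 1) 1))
    (A C : EuclideanSpace ℝ (Fin 2)) (hAC : 0 < (ε : ℝ) * (A 0 * C 1 - A 1 * C 0))
    (v : EuclideanSpace ℝ (Fin 2)) (hv : v ≠ 0) :
    wind (fun s : ℝ => toC (v - (2 * inner ℝ (M (Real.cos (Real.pi * s) • A + Real.sin (Real.pi * s) • C)) v /
      ‖M (Real.cos (Real.pi * s) • A + Real.sin (Real.pi * s) • C)‖ ^ 2) •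
        M (Real.cos (Real.pi * s) • A + Real.sin (Real.pi * s) • C))) = if s then 1 else -1 := by
  have hσ : -ε * tw = 1 ∨ -ε * tw = -1 := by
    subst htw; rcases hε with rfl | rfl <;> cases s <;> norm_num
  rw [helper_linearBeltReturn_integer M (-ε * tw) ε hσ hε hdet A C hAC v hv]
  exact linearBeltReturn_sign hε htw rfl rfl

end Summit.SmoothPoincare4.SmoothPoincare4.Theorems.AcyclicBisectionExists.ModpBraidOrbits

end
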